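import Mathlib
import HarnessLib

/-!
# S2 F8/F3d bridge: boolean-point separation from a basic-open cover of the overlap
(crux stmt-ResolutionOfSingularities-15640 `WildQuotients.WildQuotientResolution`, line `Sketch`; chain w45c
post-V5 programme S2, scaffold F8 `…ConductorOneScaffold` / frame F3d (res-D-pv-033 20:20:46Z (Q)).
[OURS · L1 W4.5c] — NOT a statement of the manuscript; folklore point-set bookkeeping. Lead prover
res-L1-w45c-lead-1.)

The frame brick HF states the separation of the boolean points as
`Disjoint ((O' : Set V)) (O.ι '' zeroLocus_O 𝔟)`; the Proj-native fact is «on the overlap `O ∩ O'` one of the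
sections in `𝔟` is invertible». The two generic lemmas below convert the latter (in either of its natural
spellings) into the former, for any open immersion `j : W ⟶ V` (`W = ↥O`, `j = O.ι`).
-/

-- single-problem summit: the doubled namespace component `ResolutionOfSingularities` is forced
set_option linter.dupNamespace false

noncomputable section

open CategoryTheory AlgebraicGeometry TopologicalSpace

namespace Summit.ResolutionOfSingularities.ResolutionOfSingularities.Theorems.WildQuotientResolution.ConductorOne

/-- **Separation from a basic-open cover of the overlap (preimage form).** If `j⁻¹(O') ≤ ⨆_{f ∈ 𝔟} D(f)` in
`W`, then `O'` misses `j(V(𝔟))`. [folklore] -/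
theorem disjoint_image_zeroLocus_of_preimage_le {W V : Scheme.{0}} (j : W ⟶ V) (O' : V.Opens)
    {U : W.Opens} (𝔟 : Set Γ(W, U))
    (h : j ⁻¹ᵁ O' ≤ ⨆ f : 𝔟, W.basicOpen (f : Γ(W, U))) :
    Disjoint ((O' : Set V)) (j.base '' W.zeroLocus 𝔟) := by
  refine Set.disjoint_left.mpr fun y hy hy' => ?_
  obtain ⟨x, hx, rfl⟩ := hy'
  have hx' : x ∈ j ⁻¹ᵁ O' := hy
  obtain ⟨f, hf⟩ := Opens.mem_iSup.mp (h hx')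
  exact (W.mem_zeroLocus_iff 𝔟 x).mp hx f f.2 hf

/-- **Separation from a basic-open cover of the overlap (image form).** If `j(W) ⊓ O' ≤ ⨆_{f ∈ 𝔟} j(D(f))`
in `V`, then `O'` misses `j(V(𝔟))`. [folklore] -/
theorem disjoint_image_zeroLocus_of_inf_le {W V : Scheme.{0}} (j : W ⟶ V) [IsOpenImmersion j]
    (O' : V.Opens) {U : W.Opens} (𝔟 : Set Γ(W, U))
    (h : j.opensRange ⊓ O' ≤ ⨆ f : 𝔟, j ''ᵁ W.basicOpen (f : Γ(W, U))) :
    Disjoint ((O' : Set V)) (j.base '' W.zeroLocus 𝔟) := by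
  refine Set.disjoint_left.mpr fun y hy hy' => ?_
  obtain ⟨x, hx, rfl⟩ := hy'
  have hmem : j.base x ∈ j.opensRange ⊓ O' := ⟨⟨x, rfl⟩, hy⟩
  obtain ⟨f, hf⟩ := Opens.mem_iSup.mp (h hmem)
  obtain ⟨x', hx', hxx'⟩ := hf
  have hxeq : x' = x := j.isOpenEmbedding.injective hxx'
  rw [hxeq] at hx'
  exact (W.mem_zeroLocus_iff 𝔟 x).mp hx f f.2 hx'

end Summit.ResolutionOfSingularities.ResolutionOfSingularities.Theorems.WildQuotientResolution.ConductorOne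

end
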